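import Literature.NumberTheory.LFunctions.SelbergArgOmegaAssembly
import Literature.NumberTheory.LFunctions.SelbergZeroDensityNearHalf
import HarnessLib

/-!
# Selberg's `Ω`-theorem for `S(t)`: the unconditional discharge

This file discharges the named fact
`Literature.NumberTheory.LFunctions.Selberg1946_zetaArgS_omega` (`SelbergArgOmega.lean`):

  `S(t) = Ω_±((log t)^{1/3} (log log t)^{-7/3})`
  (Selberg 1946; Titchmarsh, *The Theory of the Riemann Zeta-Function*, Thm 9.9 eq. (9.9.7);
   Trudgian 2011, eq. (41)).

The proof programme laid out in `SelbergArgOmega.lean` (Tsang, *Some `Ω`-theorems for the Riemann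
zeta-function*, Acta Arith. 46 (1986), §3, with the Guinand–Weil explicit formula in place of Tsang's
Lemma 5) is carried out in the sibling files `SelbergArgOmegaKernel`, `…Convolution`,
`…PrimeMoments`, `…Window`, `…OffLine` and `…Assembly`; the last proves
`SelbergOmega.Selberg1946_zetaArgS_omega_of_zeroDensity'`: the fact follows from a zero-density
estimate `N(σ, T) ≤ C T^{1 - κ(σ - 1/2)} log T` (`T ≥ T₀`, `1/2 ≤ σ ≤ 1`, some `κ > 0`). That estimate —
Selberg's zero-density theorem near the critical line (Selberg 1946, Thm 1; Titchmarsh Thm 9.19 (C)),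
in the form with an unspecified exponent — is proved in the tree as
`SelbergDensity.selberg_zeroDensity_near_half` (`SelbergZeroDensityNearHalf.lean`). Combining the two
gives the unconditional theorem.

## References

* A. Selberg, *Contributions to the theory of the Riemann zeta-function*, Arch. Math. Naturvid. 48
  (1946) no. 5, Thm 1 and §§6–7.
* [Tsang1986] K.-M. Tsang, *Some `Ω`-theorems for the Riemann zeta-function*, Acta Arith. 46 (1986)
  369–395, Thm 3 and §3.
* E. C. Titchmarsh, *The Theory of the Riemann Zeta-Function*, 2nd ed. rev. D. R. Heath-Brown (1986),
  Thm 9.9 (9.9.7), Thm 9.19 (C).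
* [TrudgianGram2011] T. S. Trudgian, *On the success and failure of Gram's Law and the Rosser Rule*,
  Acta Arith. 148 (2011), eq. (41).
-/

noncomputable section

namespace Literature.NumberTheory.LFunctions

/-- **Discharge of `Literature.NumberTheory.LFunctions.Selberg1946_zetaArgS_omega`**:
`S(t) = Ω_±((log t)^{1/3}(log log t)^{-7/3})`, unconditionally — Tsang's §3 argument
(`SelbergOmega.Selberg1946_zetaArgS_omega_of_zeroDensity'`, `SelbergArgOmegaAssembly.lean`) fed with
Selberg's zero-density theorem near the critical line
(`SelbergDensity.selberg_zeroDensity_near_half`, `SelbergZeroDensityNearHalf.lean`).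
[cite: Tsang1986, Thm 3 and §3] -/
theorem Selberg1946_zetaArgS_omega_holds : Selberg1946_zetaArgS_omega :=
  SelbergOmega.Selberg1946_zetaArgS_omega_of_zeroDensity' SelbergDensity.selberg_zeroDensity_near_half

end Literature.NumberTheory.LFunctions

end
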